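import Summits.Ventures.PercRepro.RankLevelSetRuleQSliceUnimodal
import Summits.Ventures.PercRepro.RankLevelSetRuleQSliceMapsAllD

/-!
# PercRepro — THE SLICE MAP OF RULE Q ON EVERY FAMILY `k ≥ 2`: THE FINAL STATEMENT (night-1, gen 22; dossier §34)

The complete maps `k ≤ 10` (p4's whole-cell theorems with the staircases, `rhat_slice_iff_le_ten`) and `k ≥ 5`
(`rhat_slice_iff_every_family`) in one sentence: a slice `u` is paid by Rule Q's equal split on every cell `(q+k, q)` iff
`k ≤ 4 ∨ u ≤ 1 ∨ k − 2 ≤ u`. Arithmetic level `rhat_slice_iff_all_families`, matroid level `ruleQ_slice_iff_all_families`.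
Axioms: standard.
-/

namespace PercRepro

open Set Matroid Finset

/-- **THE SLICE MAP OF RULE Q, EVERY FAMILY `k ≥ 2`** (arithmetic level). -/
theorem rhat_slice_iff_all_families (k u : ℕ) (hk : 2 ≤ k) :
    (∀ q, u ≤ q → phiK (q + k) q ≤ rhat q k (q - u)) ↔ (k ≤ 4 ∨ u ≤ 1 ∨ k - 2 ≤ u) := by
  rcases Nat.lt_or_ge k 11 with h10 | h11
  · rw [rhat_slice_iff_le_ten k u hk (by omega)]
    omega
  · rw [rhat_slice_iff_every_family k u (by omega)]
    omega

/-- **THE SLICE MAP OF RULE Q, EVERY FAMILY `k ≥ 2`, AT THE MATROID LEVEL**: at the tight layer `#E = (q+k) + q` of every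
finite matroid, the members at distance `u` from the top are paid by Rule Q's equal split on every cell iff
`k ≤ 4 ∨ u ≤ 1 ∨ k − 2 ≤ u`. -/
theorem ruleQ_slice_iff_all_families (k u : ℕ) (hk : 2 ≤ k) :
    (∀ (β : Type) (M : Matroid β) (hf : M.Finite) (q : ℕ), u ≤ q → M.E.ncard = (q + k) + q →
        ∀ Z ∈ cellMembers M (q + k) q, (flatPart M Z).ncard = q - u →
          phiK (q + k) q ≤ @ruleQRecv β M hf (q + k) q Z)
      ↔ (k ≤ 4 ∨ u ≤ 1 ∨ k - 2 ≤ u) := by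
  rcases Nat.lt_or_ge k 11 with h10 | h11
  · rw [ruleQ_slice_iff_le_ten k u hk (by omega)]
    omega
  · rw [ruleQ_slice_iff_every_family k u (by omega)]
    omega

end PercRepro
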